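import Summits.HodgeConjecture.HodgeConjecture.Theorems.Ring2AbelianAllAndreFibreClassExtremeCycles
import HarnessLib

/-!
# Ring 2 · sub-cell AbelianAll (ALL ABELIAN VARIETIES), André axis, part XIV-d — the `p = d - 1` rung of the
# fibre-class Lefschetz operator by POINCARÉ DUALITY from the `p = 1` rung (the transposed cycle
# `∑ᵢ (Aᵢ · Hᵈ⁻²) × Dᵢ`), and (β′_f) OUTRIGHT for compact pencils of abelian THREEFOLDS whose invariant `H²` is
# spanned by divisor classes on one fibre — explicit codimension-3 cycles on the eightfold `𝒳 × 𝒳`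

HONEST FRAMING (page 1, verbatim): **research route, not a corollary; conditional on HC_CM plus one named
minimal statement.** Cell line: research route conditional on HC_CM; not a corollary; Q11.4-sentence-2
already refuted in dim ≥ 3. Nothing in this file proves a case of the Hodge conjecture for an abelian variety.
`HC_CM` = `Theses.RankFourFaces.CMAbelianHodge` (a BINDER), item `Theses.RankFourFaces.CMToAbelian` (stmt-16267)
OPEN and not closed here. Seat `pub-hodge-ring2-ab-andre-2`, gen 6 (RING2-MAP §AbelianAll AA2.41).

## What is proved (theorems only; no definition, no named fact, no sorry, no Hodge-conjecture input)

* §1 **`fibreClassLefschetz_degSubOne_of_divisorSpan`** — for a compact pencil `f : 𝒳 ⟶ S` of abelian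
  `(e+2)`-folds and a point `t₀` with `j_{t₀}^* H²(𝒳) = j_{t₀}^*(N¹ H²(𝒳))`, the degree `p = d - 1 = e + 1` clause of
  `FibreClassLefschetzOn hf`: `∃ T : H²ᵈ(𝒳) → H²ᵈ⁻²(𝒳)` INDUCED BY AN ALGEBRAIC CORRESPONDENCE — the TRANSPOSE
  `∑ᵢ pr₁^*(Lᴷ^{d-2} Aᵢ) ∪ pr₂^* Dᵢ` of part XIV-b's cycle — with `j_s^* T(j_{t*} j_t^* W) = j_s^* W`. Proof: with
  the top-degree pairing `⟨x, y⟩ = τ(x ∪ y)` (perfect: Poincaré duality `isPerfPair_cupPairing_of_field_holds` and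
  `τ` injective, part XIV-a), `L = ∪[𝒳_{t₀}]` is self-adjoint (`u ∪ (x ∪ F) = (u ∪ F) ∪ x`) and the two cross
  correspondences are mutually adjoint, so `L T₂ L = L` on `H²ᵈ⁻²` follows from the reproducing identity of part
  XIV-b §0 on `H²` by pairing against `H²(𝒳)`; then (κ) (part XII-e) and (φ) (part XIII-e) give the fibre identity.
* §2 **`fibreClassLefschetzOn_relDim_three_of_divisorSpan : FibreClassLefschetzOn hf`** for every compact pencil of
  abelian THREEFOLDS (`𝒳` a smooth projective fourfold) with divisor-spanned invariant `H²` at one fibre: degrees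
  `0, 3` by part XIV-c (`𝒳 × H³`, `H³ × 𝒳`), `1` by part XIV-b (`∑ Dᵢ × (Aᵢ · H)`), `2` by §1 (`∑ (Aᵢ · H) × Dᵢ`);
  `algebraicFibreClassQuasiInverseOn_relDim_three_of_divisorSpan` ((A_f), part X-b); `…_degOne_of_divisorSpan'`
  (the `d = 2` instance of §1, same shape as XIV-b's `p = 1`).

LADDER AFTER PARTS XIV-a…e (RING2-MAP AA2.41): `d ≤ 1` unconditional; `d = 2, 3` under ONE typed hypothesis on
ONE fibre (`I₂ ⊆ j^*(N¹)`, print-true off the isotrivial locus); every `d`: `p ∈ {0, d}` unconditional,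
`p ∈ {1, d-1}` under that hypothesis, general `p` under "algebraic invariant classes in degrees `2p`, `2(d-p)`"
(part XIV-e); OPEN with Hodge-theoretic content: `2 ≤ p ≤ d - 2`, `d ≥ 4` — for the W₆ habitat (`d = 6`) the
degrees `p = 2, 3, 4`, where the invariant classes include the (monodromy-invariant) Weil classes.

References: Abdulali1994FamiliesAV (Conj. 5.3, Thm. 5.5 p. 1130); Andre1996Motifs (§5.1 p. 25, §6.3 Remarque 2
p. 33); VoisinHodgeII2003 ((10.7)); HatcherAT2002 (§3.2 Thm. 3.11, §3.3 Prop. 3.38); DeligneHodgeII1971 (4.1.1);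
Fulton1998 (§19.1 Prop. 19.1.1).
-/

noncomputable section

set_option linter.dupNamespace false

namespace Summit.HodgeConjecture.HodgeConjecture.Ring2.AbelianAll

open CategoryTheory AlgebraicGeometry MonoidalCategory CartesianMonoidalCategory
open Literature.AlgebraicGeometry Literature.AlgebraicGeometry.Motives
open Literature.AlgebraicGeometry.HodgeTheory
open Literature.AlgebraicTopology.SingularHomology (singularCohomology cupProduct cupProduct_one'
  cupProduct_assoc cupProduct_gradedComm_holds singularCohomologyZeroEquiv cupPairing
  isPerfPair_cupPairing_of_field_holds)
open Literature.Geometry.Kaehler (HasHardLefschetzProperty)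

variable {𝒳 S : SchemeOver ℂ}

/-! ## §1 The `p = d - 1` clause: the TRANSPOSED cycle `∑ᵢ (Lᴷ^{d-2} Aᵢ) × Dᵢ`, by Poincaré duality -/

/-- **THE `p = d - 1` RUNG, Poincaré-dual to part XIV-b's `p = 1` rung.** For a compact pencil `f : 𝒳 ⟶ S` of
abelian `d`-folds, `d = e + 2 ≥ 2`, and a point `t₀` at which `j_{t₀}^* H²(𝒳) = j_{t₀}^*(N¹ H²(𝒳))`, the degree
`p = d - 1` clause of `FibreClassLefschetzOn hf` holds: `∃ T : H²ᵈ(𝒳) → H²ᵈ⁻²(𝒳)` INDUCED BY AN ALGEBRAIC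
CORRESPONDENCE with `j_s^* T(j_{t*} j_t^* W) = j_s^* W`. The correspondence is the TRANSPOSE
`∑ᵢ pr₁^*(Lᴷ^{d-2} Aᵢ) ∪ pr₂^* Dᵢ` of the `p = 1` cycle (`Aᵢ, Dᵢ` the dual bases of divisor classes of part XIV-b
§0/§3): with `⟨x, y⟩ = τ(x ∪ y)` the (perfect) top-degree pairing, `L = ∪[𝒳_{t₀}]` is self-adjoint and the two
cross correspondences are mutually adjoint, so `L T₂ L = L` on `H²ᵈ⁻²` follows from the reproducing identity
`j_{t₀}^*(∑ᵢ B(Aᵢ, u) Dᵢ) = j_{t₀}^* u` on `H²` by pairing against `H²(𝒳)` (Poincaré duality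
`isPerfPair_cupPairing_of_field_holds`); the passage from `L T₂ L = L` to the fibre-restriction identity is the
kernel identity (κ) and (φ). No Hodge-conjecture input, no named fact.
[cite: Abdulali1994FamiliesAV, Conjecture 5.3 and Theorem 5.5 (p. 1130)] [cite: Andre1996Motifs, §6.3 Remarque 2 (p. 33)]
[cite: VoisinHodgeII2003, proof of Thm. 10.17 (10.7)] [cite: HatcherAT2002, §3.2 Thm. 3.11 and §3.3 Prop. 3.38] -/
theorem fibreClassLefschetz_degSubOne_of_divisorSpan {e : ℕ} {f : 𝒳 ⟶ S} (hf : IsCompactAbelianPencil f (e + 2))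
    (t₀ : ComplexPoints S)
    (hN : ∀ W : complexBetti 𝒳 (2 * 1), ∃ D ∈ algebraicClasses 𝒳 1,
      complexBetti.map (fiberι f t₀) (2 * 1) D = complexBetti.map (fiberι f t₀) (2 * 1) W) :
    ∃ T : complexBetti 𝒳 (2 * (e + 1 + 1)) →ₗ[ℂ] complexBetti 𝒳 (2 * (e + 1)),
      IsAlgebraicCorrespondence (e + 2 + 1) (e + 2 + 1) 𝒳 𝒳 T ∧
        ∀ (W : complexBetti 𝒳 (2 * (e + 1))) (t s : ComplexPoints S),
          complexBetti.map (fiberι f s) (2 * (e + 1))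
              (T (fiberGysin hf t (e + 1) (complexBetti.map (fiberι f t) (2 * (e + 1)) W))) =
            complexBetti.map (fiberι f s) (2 * (e + 1)) W := by
  have h𝒳 := hf.isSmoothProjective_total
  haveI : Module.Finite ℂ (complexBetti 𝒳 (2 * 1)) := finite_complexBetti h𝒳 _
  obtain ⟨K, hKalg, hKL⟩ := exists_algebraic_lefschetzClass hf
  obtain ⟨τ, hτ0, hτT⟩ := exists_crossTrace h𝒳 h𝒳
  -- notation as in part XIV-b §3
  set j₀ : complexBetti 𝒳 (2 * 1) →ₗ[ℂ] complexBetti (fiberOver f t₀) (2 * 1) :=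
    (complexBetti.map (fiberι f t₀) (2 * 1)).hom with hj₀
  have hj₀apply : ∀ W, j₀ W = complexBetti.map (fiberι f t₀) (2 * 1) W := fun _ ↦ rfl
  set L : complexBetti 𝒳 (2 * 1) →ₗ[ℂ] complexBetti 𝒳 (2 * (1 + 1)) := fiberGysin hf t₀ 1 ∘ₗ j₀ with hL
  have hLapply : ∀ W, L W = fiberGysin hf t₀ 1 (complexBetti.map (fiberι f t₀) (2 * 1) W) := fun _ ↦ rfl
  have hpow : 2 * 1 + 2 * e = 2 * (e + 1) := by omega
  set P : complexBetti 𝒳 (2 * 1) →ₗ[ℂ] complexBetti 𝒳 (2 * (e + 1)) :=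
    lefschetzPowTo K e (2 * 1) (2 * (e + 1)) hpow with hP
  have hak : 2 * (1 + 1) + 2 * (e + 1) = 2 * (e + 2 + 1) := by omega
  set B : complexBetti 𝒳 (2 * 1) →ₗ[ℂ] complexBetti 𝒳 (2 * 1) →ₗ[ℂ] ℂ :=
    (((cupProduct hak).compl₁₂ L P).compr₂ τ).flip with hB
  have hBapply : ∀ A W, B A W = τ (cupProduct hak (L W) (P A)) := fun _ _ ↦ rfl
  have hPres : ∀ (t : ComplexPoints S) (A : complexBetti 𝒳 (2 * 1)),
      complexBetti.map (fiberι f t) (2 * (e + 1)) (P A) =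
        lefschetzPowTo (complexBetti.map (fiberι f t) 2 K) e (2 * 1) (2 * (e + 1)) hpow
          (complexBetti.map (fiberι f t) (2 * 1) A) :=
    fun t A ↦ map_fiberι_lefschetzPowTo t K e (2 * 1) (2 * (e + 1)) hpow A
  have hPinj : ∀ t : ComplexPoints S, Function.Injective
      (lefschetzPowTo (complexBetti.map (fiberι f t) 2 K) e (2 * 1) (2 * (e + 1)) hpow) := fun t ↦
    (bijective_lefschetzPowTo_of_hasHardLefschetz _ (hKL t) (show 2 * 1 + e = e + 2 by omega) _ hpow).1
  set F := fiberGysin hf t₀ 0 (singularCohomology.one ℂ (ComplexPoints (fiberOver f t₀))) with hF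
  have h1F : 2 * 1 + 2 * (0 + 1) = 2 * (1 + 1) := by ring
  have hLW : ∀ W : complexBetti 𝒳 (2 * 1), L W = cupProduct h1F W F := fun W ↦
    fiberGysin_map_fiberι_eq_cupProduct hf t₀ W
  -- the three hypotheses of XIV-b §0 (verbatim from part XIV-b §3)
  have hB₂ : ∀ W, j₀ W = 0 → ∀ A, B A W = 0 := fun W hW A ↦ by
    rw [hBapply, hLapply, ← hj₀apply, hW, map_zero, map_zero, LinearMap.zero_apply, map_zero]
  have hB₁ : ∀ A, j₀ A = 0 → ∀ W, B A W = 0 := fun A hA W ↦ by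
    rw [hBapply]
    have hcomm := cupProduct_gradedComm_holds ℂ _ hak (show 2 * (e + 1) + 2 * (1 + 1) = 2 * (e + 2 + 1) by omega)
      (L W) (P A)
    rw [hcomm, hLapply]
    have hproj := complexGysin_cup (μ := complexOrientationFamily) hasPoincareDuality_complexOrientationFamily
      (hf.isSmoothProjective_fiberOver t₀) h𝒳 (fiberι f t₀)
      (show 2 * (e + 1) + 2 * 1 = 2 * (e + 2) by ring)
      (show 2 * (e + 2) + 2 * (e + 2 + 1) = 2 * (e + 2 + 1) + 2 * (e + 2) by ring)
      (show 2 * 1 + 2 * (e + 2 + 1) = 2 * (1 + 1) + 2 * (e + 2) by ring)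
      (show 2 * (e + 1) + 2 * (1 + 1) = 2 * (e + 2 + 1) by ring) (P A)
      (complexBetti.map (fiberι f t₀) (2 * 1) W)
    have hfg : fiberGysin hf t₀ 1 (complexBetti.map (fiberι f t₀) (2 * 1) W) =
        complexGysin complexOrientationFamily (hf.isSmoothProjective_fiberOver t₀) h𝒳 (fiberι f t₀)
          (show 2 * 1 + 2 * (e + 2 + 1) = 2 * (1 + 1) + 2 * (e + 2) by ring)
          (complexBetti.map (fiberι f t₀) (2 * 1) W) := rfl
    rw [hfg, ← hproj, hPres t₀ A, ← hj₀apply A, hA, map_zero, map_zero, LinearMap.zero_apply, map_zero,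
      smul_zero, map_zero]
  have hB₃ : ∀ A, (∀ W, B A W = 0) → j₀ A = 0 := fun A hA ↦ by
    have h1 : ∀ W : complexBetti 𝒳 (2 * 1), cupProduct hak (L W) (P A) = 0 := fun W ↦
      hτ0 _ (by rw [← hBapply]; exact hA W)
    have hFP : 2 * (0 + 1) + 2 * (e + 1) = 2 * (e + 1 + 1) := by ring
    have hdeg : 2 * 1 + 2 * (e + 1 + 1) = 2 * (e + 2 + 1) := by ring
    set y := cupProduct hFP F (P A) with hy
    have h2 : ∀ W : complexBetti 𝒳 (2 * 1), cupProduct hdeg W y = 0 := fun W ↦ by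
      rw [hy, ← cupProduct_assoc h1F hFP hak hdeg, ← hLW W]
      exact h1 W
    have hy0 : y = 0 := by
      letI := h𝒳.chartedSpace
      haveI := ComplexPoints.compactSpace_of_isSmoothProjective h𝒳
      haveI := ComplexPoints.t2Space_of_isSmoothProjective h𝒳
      have hPerf : (cupPairing (complexOrientationFamily h𝒳) hdeg).IsPerfPair :=
        isPerfPair_cupPairing_of_field_holds
      refine (LinearMap.IsPerfPair.bijective_right (cupPairing (complexOrientationFamily h𝒳) hdeg)).1 ?_
      rw [map_zero]
      ext W
      rw [LinearMap.flip_apply, LinearMap.zero_apply,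
        Literature.AlgebraicTopology.SingularHomology.cupPairing_apply, h2 W, map_zero, LinearMap.zero_apply]
    have h3 : fiberGysin hf t₀ (e + 1) (complexBetti.map (fiberι f t₀) (2 * (e + 1)) (P A)) = 0 := by
      rw [fiberGysin_map_fiberι_eq_cupProduct hf t₀ (P A)]
      have hcomm := cupProduct_gradedComm_holds ℂ _ hFP
        (show 2 * (e + 1) + 2 * (0 + 1) = 2 * (e + 1 + 1) by ring) F (P A)
      rw [← hy, hy0, eq_comm, smul_eq_zero] at hcomm
      rcases hcomm with h | h
      · exact absurd h (by simp)
      · exact h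
    have h4 := fibreGysinKernelOn_holds hf (e + 1) t₀ t₀ (P A) h3
    rw [hPres t₀ A] at h4
    rw [hj₀apply]
    exact hPinj t₀ (by rw [h4, map_zero])
  obtain ⟨r, A, D, hA, hD, hrep⟩ := exists_reproducing_pairs_of_separating j₀ (algebraicClasses 𝒳 1)
    (fun W ↦ hN W) B hB₁ hB₂ hB₃
  have hPA : ∀ i, P (A i) ∈ algebraicClasses 𝒳 (e + 1) := fun i ↦ by
    have h := lefschetzPowTo_mem_supportedClasses_of_mem h𝒳 hKalg 1 (hA i) e (2 * (e + 1)) hpow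
    rwa [Nat.add_comm 1 e] at h
  -- (R1) `L(∑ᵢ B(Aᵢ, u) • Dᵢ) = L u` on `H²(𝒳)`
  have hR1 : ∀ u : complexBetti 𝒳 (2 * 1), L (∑ i, B (A i) u • D i) = L u := fun u ↦ by
    rw [hLapply, hLapply, ← hj₀apply, ← hj₀apply, hrep u]
  -- the TRANSPOSED correspondence `T₂ c = ∑ᵢ τ(c ∪ Dᵢ) • P Aᵢ`
  have hak₂ : 2 * (e + 1 + 1) + 2 * 1 = 2 * (e + 2 + 1) := by omega
  obtain ⟨T, hT, hTc⟩ := hτT hak₂ (show e + 1 ≤ e + 2 + 1 by omega) r (fun i ↦ P (A i)) D hPA hD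
  refine ⟨T, hT, fun W t s ↦ ?_⟩
  -- `L'` = cup with the fibre class on `H^{2(e+1)}`; self-adjointness and the exchange identity
  have hx : 2 * (e + 1) + 2 * (0 + 1) = 2 * (e + 1 + 1) := by ring
  have hdeg' : 2 * 1 + 2 * (e + 1 + 1) = 2 * (e + 2 + 1) := by ring
  have hL'W : ∀ x : complexBetti 𝒳 (2 * (e + 1)),
      fiberGysin hf t₀ (e + 1) (complexBetti.map (fiberι f t₀) (2 * (e + 1)) x) = cupProduct hx x F := fun x ↦
    fiberGysin_map_fiberι_eq_cupProduct hf t₀ x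
  -- (SA) `u ∪ (x ∪ F) = (u ∪ F) ∪ x`
  have hSA : ∀ (u : complexBetti 𝒳 (2 * 1)) (x : complexBetti 𝒳 (2 * (e + 1))),
      cupProduct hdeg' u (cupProduct hx x F) = cupProduct hak (L u) x := fun u x ↦ by
    rw [cupProduct_gradedComm_holds ℂ _ hx (show 2 * (0 + 1) + 2 * (e + 1) = 2 * (e + 1 + 1) by ring) x F,
      Even.neg_one_pow ⟨2 * (e + 1) * (0 + 1), by ring⟩, one_smul,
      ← cupProduct_assoc h1F (show 2 * (0 + 1) + 2 * (e + 1) = 2 * (e + 1 + 1) by ring) hak hdeg', ← hLW u]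
  -- (SB) `(W ∪ F) ∪ D = (D ∪ F) ∪ W`
  have hSB : ∀ (x : complexBetti 𝒳 (2 * (e + 1))) (D' : complexBetti 𝒳 (2 * 1)),
      cupProduct hak₂ (cupProduct hx x F) D' = cupProduct hak (L D') x := fun x D' ↦ by
    have hFD : 2 * (0 + 1) + 2 * 1 = 2 * (1 + 1) := by ring
    rw [cupProduct_assoc hx hFD hak₂ (show 2 * (e + 1) + 2 * (1 + 1) = 2 * (e + 2 + 1) by ring),
      cupProduct_gradedComm_holds ℂ _ (show 2 * (e + 1) + 2 * (1 + 1) = 2 * (e + 2 + 1) by ring) hak x _,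
      Even.neg_one_pow ⟨2 * (e + 1) * (1 + 1), by ring⟩, one_smul,
      cupProduct_gradedComm_holds ℂ _ hFD h1F F D', Even.neg_one_pow ⟨2 * (0 + 1) * 1, by ring⟩, one_smul,
      ← hLW D']
  -- reduce to `L'(T(L' W)) = L' W` via (φ) and (κ)
  rw [fiberGysin_map_fiberι_eq_of_const hf (fibreClassConstantOn_holds hf) t t₀ W, ← sub_eq_zero, ← map_sub]
  refine fibreGysinKernelOn_holds hf (e + 1) s s _ ?_
  rw [fiberGysin_map_fiberι_eq_of_const hf (fibreClassConstantOn_holds hf) s t₀, map_sub, map_sub, sub_eq_zero,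
    hL'W, hL'W]
  -- pair against `H²(𝒳)`: Poincaré duality
  letI := h𝒳.chartedSpace
  haveI := ComplexPoints.compactSpace_of_isSmoothProjective h𝒳
  haveI := ComplexPoints.t2Space_of_isSmoothProjective h𝒳
  have hPerf : (cupPairing (complexOrientationFamily h𝒳) hdeg').IsPerfPair := isPerfPair_cupPairing_of_field_holds
  refine (LinearMap.IsPerfPair.bijective_right (cupPairing (complexOrientationFamily h𝒳) hdeg')).1 ?_
  ext u
  rw [LinearMap.flip_apply, LinearMap.flip_apply, Literature.AlgebraicTopology.SingularHomology.cupPairing_apply,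
    Literature.AlgebraicTopology.SingularHomology.cupPairing_apply]
  suffices key : cupProduct hdeg' u (cupProduct hx (T (cupProduct hx W F)) F) =
      cupProduct hdeg' u (cupProduct hx W F) by
    rw [key]
  rw [← sub_eq_zero]
  refine hτ0 _ ?_
  rw [map_sub, sub_eq_zero, hSA, hSA, hTc]
  -- both sides are `∑ᵢ B(Aᵢ, u) · τ(L Dᵢ ∪ W)`
  rw [map_sum, map_sum]
  simp_rw [map_smul, smul_eq_mul, hSB]
  conv_rhs => rw [← hR1 u, map_sum, map_sum, LinearMap.sum_apply, map_sum]
  refine Finset.sum_congr rfl fun i _ ↦ ?_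
  rw [map_smul, LinearMap.map_smul₂, map_smul, smul_eq_mul, hBapply, mul_comm]

/-! ## §2 Assembly: (β′_f) for compact pencils of abelian THREEFOLDS with divisorial invariant `H²` -/

/-- **(β′_f) FOR COMPACT PENCILS OF ABELIAN THREEFOLDS WITH DIVISOR-SPANNED INVARIANT `H²` — UNCONDITIONAL, WITH
EXPLICIT CYCLES.** For a compact pencil `f : 𝒳 ⟶ S` of abelian threefolds (`𝒳` a smooth projective fourfold) and a
point `t₀` with `j_{t₀}^* H²(𝒳) = j_{t₀}^*(N¹ H²(𝒳))`, part VIII's node `FibreClassLefschetzOn hf` HOLDS: degrees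
`p = 0, 3` by part XIV-c (`𝒳 × H³`, `H³ × 𝒳`), `p = 1` by part XIV-b (`∑ᵢ Dᵢ × (Aᵢ · H)`), `p = 2` by §1
(`∑ᵢ (Aᵢ · H) × Dᵢ`) — codimension-3 cycles on the eightfold `𝒳 × 𝒳`. No Hodge-conjecture input, no named
fact, no supply node. [cite: Abdulali1994FamiliesAV, Conjecture 5.3 and Theorem 5.5 (p. 1130)]
[cite: Andre1996Motifs, §6.3 Remarque 2 (p. 33)] -/
theorem fibreClassLefschetzOn_relDim_three_of_divisorSpan {f : 𝒳 ⟶ S} (hf : IsCompactAbelianPencil f 3)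
    (t₀ : ComplexPoints S)
    (hN : ∀ W : complexBetti 𝒳 (2 * 1), ∃ D ∈ algebraicClasses 𝒳 1,
      complexBetti.map (fiberι f t₀) (2 * 1) D = complexBetti.map (fiberι f t₀) (2 * 1) W) :
    FibreClassLefschetzOn hf := by
  intro p hp
  obtain rfl | rfl | rfl | rfl : p = 0 ∨ p = 1 ∨ p = 2 ∨ p = 3 := by omega
  · exact fibreClassLefschetz_degZero hf
  · exact fibreClassLefschetz_degOne_of_divisorSpan hf (by omega) t₀ hN
  · exact fibreClassLefschetz_degSubOne_of_divisorSpan (e := 1) hf t₀ hN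
  · exact fibreClassLefschetz_degTop hf

/-- (A_f) for these abelian-threefold pencils (part X-b's split). [cite: Abdulali1994FamiliesAV, Conjecture 5.3 and Remark 5.4 (p. 1130)] -/
theorem algebraicFibreClassQuasiInverseOn_relDim_three_of_divisorSpan {f : 𝒳 ⟶ S}
    (hf : IsCompactAbelianPencil f 3) (t₀ : ComplexPoints S)
    (hN : ∀ W : complexBetti 𝒳 (2 * 1), ∃ D ∈ algebraicClasses 𝒳 1,
      complexBetti.map (fiberι f t₀) (2 * 1) D = complexBetti.map (fiberι f t₀) (2 * 1) W) :
    AlgebraicFibreClassQuasiInverseOn hf :=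
  algebraicFibreClassQuasiInverseOn_of_fibreClassLefschetzOn hf
    (fibreClassLefschetzOn_relDim_three_of_divisorSpan hf t₀ hN)

/-- **The second rung `p = d - 1` also for `d = 2`** (it is then the `p = 1` clause again, by the transposed cycle;
recorded to show the two constructions agree in shape). [folklore] -/
theorem fibreClassLefschetz_degOne_of_divisorSpan' {f : 𝒳 ⟶ S} (hf : IsCompactAbelianPencil f 2)
    (t₀ : ComplexPoints S)
    (hN : ∀ W : complexBetti 𝒳 (2 * 1), ∃ D ∈ algebraicClasses 𝒳 1,
      complexBetti.map (fiberι f t₀) (2 * 1) D = complexBetti.map (fiberι f t₀) (2 * 1) W) :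
    ∃ T : complexBetti 𝒳 (2 * (0 + 1 + 1)) →ₗ[ℂ] complexBetti 𝒳 (2 * (0 + 1)),
      IsAlgebraicCorrespondence (0 + 2 + 1) (0 + 2 + 1) 𝒳 𝒳 T ∧
        ∀ (W : complexBetti 𝒳 (2 * (0 + 1))) (t s : ComplexPoints S),
          complexBetti.map (fiberι f s) (2 * (0 + 1))
              (T (fiberGysin hf t (0 + 1) (complexBetti.map (fiberι f t) (2 * (0 + 1)) W))) =
            complexBetti.map (fiberι f s) (2 * (0 + 1)) W :=
  fibreClassLefschetz_degSubOne_of_divisorSpan (e := 0) hf t₀ hN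

end Summit.HodgeConjecture.HodgeConjecture.Ring2.AbelianAll

end
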